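import Literature.AlgebraicGeometry.HodgeTheory.WeilClassesCyclicPrymLefschetz
import Literature.AlgebraicGeometry.HodgeTheory.AbelianVarietyPullbackAlgebraicClasses
import Literature.AlgebraicGeometry.Motives.JacobianDimensionBounds
import HarnessLib

/-!
# Schoen's cyclic Prym fact: the two remaining inputs cut down to their kernels

Topic `AlgebraicGeometry/HodgeTheory`; namespace `Literature.AlgebraicGeometry.HodgeTheory`. Fifth
theorem-only companion (no definition, no named fact, sorry-free) of the named fact
`Literature.AlgebraicGeometry.HodgeTheory.Schoen1988_cyclicPrym_weilClasses_algebraic_degreeSix`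
(`WeilClassesCyclicPrym.lean`; C. Schoen, Compositio Math. 65 (1988), Cor. 3.1 with Thm. 2.0 —
Patel–Zhang, arXiv:2506.13729, Thm 5.3 — for an étale `ℤ/6`-cover of a genus-`5` curve), after
`…Typing` (p95557), `…Dimension` (p102981), `…Lefschetz` (p107929), where the fact was proved to
follow from

* (i) the named fact `Motives.isIso_bettiCohomology_map_abelJacobi` (`(f^P)^* : H¹(J(C)) ≅ H¹(C)` for
  ALL smooth projective complex curves), and
* (iii) Schoen's cycle: ONE non-zero algebraic class in the Weil LINE `E₊ = ⋀⁸ H¹(B)_{i√3}`.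

Here both inputs are weakened to what the printed proof actually uses of them:

* **(i′) the inequality `b₁(C(ℂ)) ≤ 2 dim J(C)` for the Schoen curve itself** — the open half of
  Milne, *Jacobian Varieties*, Prop. 2.1 (`dim J = g`; the other half
  `Jacobian.two_mul_dim_le_finrank_bettiCohomology` and the criterion
  `Jacobian.isIso_bettiCohomology_map_abelJacobi_of_finrank_le_two_mul_dim` are theorems of
  `Motives/JacobianDimensionBounds`): `dim_kerComponent_cyclotomic₆_pushforward_eq_eight_of_finrank_le`
  re-runs the Chevalley–Weil count of `…Lefschetz` with the per-curve isomorphism; in particular the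
  fact follows from EITHER of the two (equivalent, `two_mul_dim_eq_finrank_bettiCohomology_iff_isIso`)
  named facts of `Motives/Jacobian` over `ℂ`;
* **(iii′) ONE non-zero algebraic class ANYWHERE in the Weil PLANE `E₊ ⊔ E₋`** (equivalently: an
  algebraic class on `B`, or on `J` restricted to `B`, which some polynomial in `(2·𝟙 + ψ₀)^*` moves to
  a non-zero Weil class): its two eigen-components `(T₈ - λ∓) c / (λ± - λ∓)` are again algebraic,
  because pull-back along the endomorphism `2·𝟙 + ψ₀` of `B` preserves algebraic classes
  (`map_mem_algebraicClasses_of_abelianVariety`, Fulton Cor. 19.2 (b) via Kleiman's moving lemma, a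
  theorem of the tree) and `λ₊ = (2 + i√3)⁸ ≠ (2 - i√3)⁸ = λ₋` (`two_sub_I_mul_sqrt_three_pow_ne`);
  one of them is non-zero, and the typing brick (`weilClassesOf_le_algebraicClasses_of_exists_mem_
  weilClassesPlus/Minus`: the line through it and its complex conjugate) concludes. This is the
  shape in which Schoen's Thm. 2.0 (p. 13, case `r = 0`: "the cohomology class of `z_χ` is non-trivial
  and lies in `U ⊗ ℚ(μ_m)`", `z_χ = Σ_t χ(t)·t_* Q` an eigen-combination of translates of ONE cycle)
  and Patel–Zhang Prop. 3.2 / Thm. 4.4 (`U` is spanned by the classes `[Q_t]`) deliver the cycle.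

Assemblies: `Schoen1988_cyclicPrym_weilClasses_algebraic_degreeSix_of_finrank_le_of_exists_weilClass`
(T ⟸ (i′) ∧ (iii′)), `…_of_two_mul_dim_eq_of_exists_weilClass`, `…_of_isIso_of_exists_weilClass`.
What remains unproved is unchanged in nature: the theorem of Abel–Jacobi `b₁(C(ℂ)) ≤ 2 dim J`
(Milne Prop. 2.1 / Thm. 2.5; Lange §4.1.1) and Schoen's geometric cycle (symmetric powers of the
quotient curve, the Abel–Jacobi projective bundle, the class-field-theory square).

## References

* [Schoen1988HodgeWeil] C. Schoen, *Hodge classes on self-products of a variety with an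
  automorphism*, Compositio Math. 65 (1988): Thm. 2.0 (p. 11, proof p. 13), §3 Cor. 3.1 (p. 24).
* [PatelZhang2025PrymHodge] D. Patel, Y. Zhang, arXiv:2506.13729 (2025): Prop. 3.2, Thm. 4.4,
  Lemma 5.1, Thm. 5.3.
* [Milne1986JacobianVarieties] J. S. Milne, *Jacobian Varieties* (Cornell–Silverman 1986): Prop. 2.1,
  Thm. 2.5.
* [Lange2023AbelianVarietiesC] H. Lange, *Abelian Varieties over the Complex Numbers* (2023), §4.1.1,
  Lemma 4.4.1.
* [Fulton1998] W. Fulton, *Intersection Theory*, Cor. 19.2 (b).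
* [vanGeemen1994HodgeAV] B. van Geemen, LNM 1594 (1994), 4.9, proof of Lemma 5.2 (6).
-/

noncomputable section

open CategoryTheory AlgebraicGeometry

namespace Literature.AlgebraicGeometry.HodgeTheory

open Literature.AlgebraicTopology.SingularHomology Literature.AlgebraicGeometry.Motives

/-! ### §1 Linear algebra: the two components of a vector in a sum of two eigenspaces -/

section TwoEigenvalues

variable {F V : Type*} [Field F] [AddCommGroup V] [Module F V]

/-- For `v = x + y` with `T x = a x`, `T y = b y`: `T v - b v = (a - b) x`. [folklore] -/
theorem apply_sub_smul_eq_of_mem_eigenspace (T : Module.End F V) {a b : F} {x y : V}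
    (hx : x ∈ T.eigenspace a) (hy : y ∈ T.eigenspace b) :
    T (x + y) - b • (x + y) = (a - b) • x := by
  rw [Module.End.mem_eigenspace_iff] at hx hy
  rw [map_add, hx, hy, sub_smul, smul_add]
  abel

/-- **Eigen-components are polynomials in the operator.** If `v ∈ ker(T - a) ⊔ ker(T - b)` with
`a ≠ b`, then `v₊ := (a - b)⁻¹ (T v - b v) ∈ ker(T - a)`, `v₋ := (b - a)⁻¹ (T v - a v) ∈ ker(T - b)`
and `v = v₊ + v₋`. [folklore] -/
theorem eigenComponents_of_mem_sup (T : Module.End F V) {a b : F} (hab : a ≠ b) {v : V}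
    (hv : v ∈ T.eigenspace a ⊔ T.eigenspace b) :
    (a - b)⁻¹ • (T v - b • v) ∈ T.eigenspace a ∧ (b - a)⁻¹ • (T v - a • v) ∈ T.eigenspace b ∧
      v = (a - b)⁻¹ • (T v - b • v) + (b - a)⁻¹ • (T v - a • v) := by
  obtain ⟨x, hx, y, hy, rfl⟩ := Submodule.mem_sup.1 hv
  have hab' : a - b ≠ 0 := sub_ne_zero.2 hab
  have hba' : b - a ≠ 0 := sub_ne_zero.2 hab.symm
  have h₁ : (a - b)⁻¹ • (T (x + y) - b • (x + y)) = x := by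
    rw [apply_sub_smul_eq_of_mem_eigenspace T hx hy, inv_smul_smul₀ hab']
  have h₂ : (b - a)⁻¹ • (T (x + y) - a • (x + y)) = y := by
    rw [add_comm x y, apply_sub_smul_eq_of_mem_eigenspace T hy hx, inv_smul_smul₀ hba']
  rw [h₁, h₂]
  exact ⟨hx, hy, rfl⟩

/-- A submodule stable under `T` is stable under every polynomial in `T`. [folklore] -/
theorem aeval_apply_mem_of_forall_apply_mem {S : Submodule F V} {T : Module.End F V}
    (hT : ∀ v ∈ S, T v ∈ S) (p : Polynomial F) {v : V} (hv : v ∈ S) :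
    Polynomial.aeval T p v ∈ S := by
  refine Polynomial.induction_on' p (fun p q hp hq => ?_) (fun n a => ?_)
  · rw [map_add, LinearMap.add_apply]
    exact S.add_mem hp hq
  · rw [Polynomial.aeval_monomial, Module.End.mul_apply, Module.algebraMap_end_apply]
    refine S.smul_mem a ?_
    induction n with
    | zero => simpa using hv
    | succ n ih =>
      rw [pow_succ', Module.End.mul_apply]
      exact hT _ ih

end TwoEigenvalues

/-! ### §2 Algebraic classes on an abelian variety are stable under pull-back by its endomorphisms -/

section Stability

variable {B : Motives.AbelianVariety ℂ}

/-- **Pull-back along an endomorphism of an abelian variety preserves algebraic classes**: the case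
`X = B`, `g : B → B` of the tree's `map_mem_algebraicClasses_of_abelianVariety` (contravariance of
cycle classes for morphisms of non-singular varieties into an abelian variety, Fulton Cor. 19.2 (b),
proved there through Kleiman's moving lemma). [cite: Fulton1998, §19.2 Cor. 19.2 (b) and Appendix B.9.2 (a)] -/
theorem map_mem_algebraicClasses_of_endomorphism (g : B.X ⟶ B.X) {p : ℕ} {c : complexBetti B.X (2 * p)}
    (hc : c ∈ algebraicClasses B.X p) : complexBetti.map g (2 * p) c ∈ algebraicClasses B.X p :=
  map_mem_algebraicClasses_of_abelianVariety
    (Motives.AbelianVariety.isSmoothProjective_holds : Motives.IsSmoothProjective B.dim B.X) B g hc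

/-- … hence so does every polynomial in the pull-back `g^*`. [cite: Fulton1998, §19.2 Cor. 19.2 (b)] -/
theorem aeval_map_mem_algebraicClasses (g : B.X ⟶ B.X) {p : ℕ} (q : Polynomial ℂ)
    {c : complexBetti B.X (2 * p)} (hc : c ∈ algebraicClasses B.X p) :
    Polynomial.aeval (complexBetti.map g (2 * p)).hom q c ∈ algebraicClasses B.X p :=
  aeval_apply_mem_of_forall_apply_mem (fun _ hv => map_mem_algebraicClasses_of_endomorphism g hv) q hc

/-- Pull-back along the inclusion `ι : B' ↪ J` of an abelian subvariety (indeed along any homomorphism of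
abelian varieties) preserves algebraic classes. [cite: Fulton1998, §19.2 Cor. 19.2 (b)] -/
theorem map_mem_algebraicClasses_of_hom {J : Motives.AbelianVariety ℂ} (ι : B ⟶ J) {p : ℕ}
    {b : complexBetti J.X (2 * p)} (hb : b ∈ algebraicClasses J.X p) :
    complexBetti.map ι.hom.hom.hom (2 * p) b ∈ algebraicClasses B.X p :=
  map_mem_algebraicClasses_of_abelianVariety
    (Motives.AbelianVariety.isSmoothProjective_holds : Motives.IsSmoothProjective B.dim B.X) J _ hb

end Stability

/-! ### §3 One non-zero algebraic class anywhere in the Weil plane `E₊ ⊔ E₋` suffices -/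

section OneWeilClass

variable {B : Motives.AbelianVariety ℂ} {ψ₀ : B ⟶ B}

/-- `λ₊ = (2 + i√3)⁸ ≠ (2 - i√3)⁸ = λ₋`. [folklore] -/
theorem two_add_I_mul_sqrt_three_pow_eight_ne :
    (2 + Complex.I * (Real.sqrt (3 : ℝ) : ℂ)) ^ 8 ≠ (2 - Complex.I * (Real.sqrt (3 : ℝ) : ℂ)) ^ 8 :=
  fun h => two_sub_I_mul_sqrt_three_pow_ne (b := 8) (by norm_num) le_rfl h.symm

/-- **The eigen-components of an algebraic class of `H⁸(B)` in the Weil plane are algebraic.** For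
`c ∈ E₊ ⊔ E₋`, `E± = Eig(T₈, λ±)`, `T₈ = (2·𝟙 + ψ₀)^*|H⁸`, `λ± = (2 ± i√3)⁸`: the components
`c₊ = (λ₊ - λ₋)⁻¹ (T₈ c - λ₋ c) ∈ E₊`, `c₋ = (λ₋ - λ₊)⁻¹ (T₈ c - λ₊ c) ∈ E₋` are algebraic when `c` is
(pull-back by the endomorphism `2·𝟙 + ψ₀` preserves algebraic classes), and `c = c₊ + c₋`.
[cite: Fulton1998, §19.2 Cor. 19.2 (b)] [cite: Schoen1988HodgeWeil, §2 p. 13 (proof of Thm. 2.0, case r = 0)] -/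
theorem exists_eigenComponents_mem_algebraicClasses {c : complexBetti B.X 8}
    (hc : c ∈ Module.End.eigenspace (complexBetti.map ((2 : ℤ) • 𝟙 B + ψ₀).hom.hom.hom 8).hom
          ((2 + Complex.I * (Real.sqrt (3 : ℝ) : ℂ)) ^ 8) ⊔
        Module.End.eigenspace (complexBetti.map ((2 : ℤ) • 𝟙 B + ψ₀).hom.hom.hom 8).hom
          ((2 - Complex.I * (Real.sqrt (3 : ℝ) : ℂ)) ^ 8))
    (ha : c ∈ algebraicClasses B.X 4) :
    ∃ c₁ ∈ Module.End.eigenspace (complexBetti.map ((2 : ℤ) • 𝟙 B + ψ₀).hom.hom.hom 8).hom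
          ((2 + Complex.I * (Real.sqrt (3 : ℝ) : ℂ)) ^ 8),
      ∃ c₂ ∈ Module.End.eigenspace (complexBetti.map ((2 : ℤ) • 𝟙 B + ψ₀).hom.hom.hom 8).hom
          ((2 - Complex.I * (Real.sqrt (3 : ℝ) : ℂ)) ^ 8),
        c₁ ∈ algebraicClasses B.X 4 ∧ c₂ ∈ algebraicClasses B.X 4 ∧ c = c₁ + c₂ := by
  set T := (complexBetti.map ((2 : ℤ) • 𝟙 B + ψ₀).hom.hom.hom 8).hom with hT
  set a : ℂ := (2 + Complex.I * (Real.sqrt (3 : ℝ) : ℂ)) ^ 8 with ha'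
  set b : ℂ := (2 - Complex.I * (Real.sqrt (3 : ℝ) : ℂ)) ^ 8 with hb'
  obtain ⟨hc₁, hc₂, hsum⟩ := eigenComponents_of_mem_sup T (a := a) (b := b)
    two_add_I_mul_sqrt_three_pow_eight_ne hc
  have hTc : T c ∈ algebraicClasses B.X 4 :=
    map_mem_algebraicClasses_of_endomorphism (p := 4) ((2 : ℤ) • 𝟙 B + ψ₀).hom.hom.hom ha
  refine ⟨_, hc₁, _, hc₂, ?_, ?_, hsum⟩
  · exact Submodule.smul_mem _ _ (Submodule.sub_mem _ hTc (Submodule.smul_mem _ _ ha))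
  · exact Submodule.smul_mem _ _ (Submodule.sub_mem _ hTc (Submodule.smul_mem _ _ ha))

/-- **One non-zero algebraic Weil class makes the whole Weil plane algebraic.** For a complex abelian
variety `B` of dimension `8` with `ψ₀ ≫ ψ₀ = -3`: if the plane
`Eig(T₈, (2 + i√3)⁸) ⊔ Eig(T₈, (2 - i√3)⁸) = E₊ ⊔ E₋ = ⋀⁸H¹_{i√3} ⊕ ⋀⁸H¹_{-i√3}` (`T₈ = (2·𝟙 + ψ₀)^*`;
`eigenspace_sup_eigenspace_eq_weilClassesOf`) contains ONE non-zero algebraic class, every class of it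
is algebraic: one eigen-component of that class is a non-zero algebraic class in a Weil LINE
(`exists_eigenComponents_mem_algebraicClasses`), which spans it, and its complex conjugate spans the
other line (`weilClassesOf_le_algebraicClasses_of_exists_mem_weilClassesPlus/Minus`).
[cite: Schoen1988HodgeWeil, §1 Lemma 1.2 and §2 p. 13 (proof of Thm. 2.0, case r = 0)]
[cite: vanGeemen1994HodgeAV, 4.9 and proof of Lemma 5.2 (6)] -/
theorem eigenspace_sup_eigenspace_le_algebraicClasses_of_exists (hdim : B.dim = 8)
    (hψ : ψ₀ ≫ ψ₀ = -(3 • 𝟙 B))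
    (h : ∃ c ∈ Module.End.eigenspace (complexBetti.map ((2 : ℤ) • 𝟙 B + ψ₀).hom.hom.hom 8).hom
          ((2 + Complex.I * (Real.sqrt (3 : ℝ) : ℂ)) ^ 8) ⊔
        Module.End.eigenspace (complexBetti.map ((2 : ℤ) • 𝟙 B + ψ₀).hom.hom.hom 8).hom
          ((2 - Complex.I * (Real.sqrt (3 : ℝ) : ℂ)) ^ 8),
      c ∈ algebraicClasses B.X 4 ∧ c ≠ 0) :
    Module.End.eigenspace (complexBetti.map ((2 : ℤ) • 𝟙 B + ψ₀).hom.hom.hom 8).hom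
          ((2 + Complex.I * (Real.sqrt (3 : ℝ) : ℂ)) ^ 8) ⊔
        Module.End.eigenspace (complexBetti.map ((2 : ℤ) • 𝟙 B + ψ₀).hom.hom.hom 8).hom
          ((2 - Complex.I * (Real.sqrt (3 : ℝ) : ℂ)) ^ 8) ≤
      algebraicClasses B.X 4 := by
  have hX := Motives.abelianVarietyCohomologyExteriorH1_holds
  have hΛ := hX.hasExteriorCohomologyH1 B
  have hb₁ : Module.finrank ℂ (complexBetti B.X 1) = 2 * (2 * 4) := by rw [hX.finrank_one B, hdim]
  obtain ⟨c, hc, hca, hc0⟩ := h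
  obtain ⟨c₁, hc₁, c₂, hc₂, ha₁, ha₂, hsum⟩ := exists_eigenComponents_mem_algebraicClasses hc hca
  rw [eigenspace_sup_eigenspace_eq_weilClassesOf hΛ hψ]
  rw [eigenspace_two_add_weilOperator_eq_weilClassesPlus hΛ hψ] at hc₁
  rw [eigenspace_two_add_weilOperator_eq_weilClassesMinus hΛ hψ] at hc₂
  by_cases h0 : c₁ = 0
  · have hne : c₂ ≠ 0 := by
      rintro rfl
      exact hc0 (by rw [hsum, h0, add_zero])
    exact weilClassesOf_le_algebraicClasses_of_exists_mem_weilClassesMinus hΛ hb₁ (by norm_num) hψ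
      ⟨c₂, hc₂, ha₂, hne⟩
  · exact weilClassesOf_le_algebraicClasses_of_exists_mem_weilClassesPlus hΛ hb₁ (by norm_num) hψ
      ⟨c₁, hc₁, ha₁, h0⟩

/-- **Polynomial movers.** The same conclusion from an algebraic class `c ∈ H⁸(B)` and a polynomial `q`
such that `q(T₈) c` is a NON-ZERO class of the Weil plane (`q(T₈) c` is again algebraic,
`aeval_map_mem_algebraicClasses`) — e.g. an eigen-projector applied to the class of a cycle, as in
Schoen's `z_χ = Σ_t χ(t) t_* Q`. [cite: Schoen1988HodgeWeil, §2 p. 13 (proof of Thm. 2.0, case r = 0)] -/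
theorem eigenspace_sup_eigenspace_le_algebraicClasses_of_exists_aeval (hdim : B.dim = 8)
    (hψ : ψ₀ ≫ ψ₀ = -(3 • 𝟙 B))
    (h : ∃ c ∈ algebraicClasses B.X 4, ∃ q : Polynomial ℂ,
      Polynomial.aeval (complexBetti.map ((2 : ℤ) • 𝟙 B + ψ₀).hom.hom.hom 8).hom q c ∈
          Module.End.eigenspace (complexBetti.map ((2 : ℤ) • 𝟙 B + ψ₀).hom.hom.hom 8).hom
              ((2 + Complex.I * (Real.sqrt (3 : ℝ) : ℂ)) ^ 8) ⊔
            Module.End.eigenspace (complexBetti.map ((2 : ℤ) • 𝟙 B + ψ₀).hom.hom.hom 8).hom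
              ((2 - Complex.I * (Real.sqrt (3 : ℝ) : ℂ)) ^ 8) ∧
        Polynomial.aeval (complexBetti.map ((2 : ℤ) • 𝟙 B + ψ₀).hom.hom.hom 8).hom q c ≠ 0) :
    Module.End.eigenspace (complexBetti.map ((2 : ℤ) • 𝟙 B + ψ₀).hom.hom.hom 8).hom
          ((2 + Complex.I * (Real.sqrt (3 : ℝ) : ℂ)) ^ 8) ⊔
        Module.End.eigenspace (complexBetti.map ((2 : ℤ) • 𝟙 B + ψ₀).hom.hom.hom 8).hom
          ((2 - Complex.I * (Real.sqrt (3 : ℝ) : ℂ)) ^ 8) ≤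
      algebraicClasses B.X 4 := by
  obtain ⟨c, hca, q, hq, hq0⟩ := h
  exact eigenspace_sup_eigenspace_le_algebraicClasses_of_exists hdim hψ
    ⟨_, hq, aeval_map_mem_algebraicClasses (p := 4) _ q hca, hq0⟩

/-- **From the Jacobian side.** The same conclusion from an algebraic class `b ∈ H⁸(J)` on an ambient
abelian variety `J ⊇ B` (e.g. the Jacobian, `ι = kerComponentι`) whose restriction `ι^* b` to `B` is a
non-zero class of the Weil plane: `ι^* b` is algebraic (`map_mem_algebraicClasses_of_hom`). This is the
route of Schoen's Cor. 3.1 (cycles on `Alb(C) = J(C)`, then the primitive Prym `B ⊂ J`).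
[cite: Schoen1988HodgeWeil, §3 Cor. 3.1 (p. 24)] -/
theorem eigenspace_sup_eigenspace_le_algebraicClasses_of_exists_restrict {J : Motives.AbelianVariety ℂ}
    (ι : B ⟶ J) (hdim : B.dim = 8) (hψ : ψ₀ ≫ ψ₀ = -(3 • 𝟙 B))
    (h : ∃ b ∈ algebraicClasses J.X 4,
      complexBetti.map ι.hom.hom.hom 8 b ∈
          Module.End.eigenspace (complexBetti.map ((2 : ℤ) • 𝟙 B + ψ₀).hom.hom.hom 8).hom
              ((2 + Complex.I * (Real.sqrt (3 : ℝ) : ℂ)) ^ 8) ⊔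
            Module.End.eigenspace (complexBetti.map ((2 : ℤ) • 𝟙 B + ψ₀).hom.hom.hom 8).hom
              ((2 - Complex.I * (Real.sqrt (3 : ℝ) : ℂ)) ^ 8) ∧
        complexBetti.map ι.hom.hom.hom 8 b ≠ 0) :
    Module.End.eigenspace (complexBetti.map ((2 : ℤ) • 𝟙 B + ψ₀).hom.hom.hom 8).hom
          ((2 + Complex.I * (Real.sqrt (3 : ℝ) : ℂ)) ^ 8) ⊔
        Module.End.eigenspace (complexBetti.map ((2 : ℤ) • 𝟙 B + ψ₀).hom.hom.hom 8).hom
          ((2 - Complex.I * (Real.sqrt (3 : ℝ) : ℂ)) ^ 8) ≤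
      algebraicClasses B.X 4 := by
  obtain ⟨b, hb, hι, hι0⟩ := h
  exact eigenspace_sup_eigenspace_le_algebraicClasses_of_exists hdim hψ
    ⟨_, hι, map_mem_algebraicClasses_of_hom (p := 4) ι hb, hι0⟩

end OneWeilClass

/-! ### §4 The Jacobian input cut down to the Schoen curve: `b₁(C(ℂ)) ≤ 2 dim J` ⇒ `dim B = 8` -/

section JacobianPerCurve

variable {C : Motives.SchemeOver ℂ} (𝒥 : Jacobian C)

/-- `(f^P)^* : H¹(J(ℂ); ℂ) → H¹(C(ℂ); ℂ)` is bijective as soon as it is an isomorphism over `ℚ` at the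
point `P` (per-curve form of `bijective_complexBetti_map_abelJacobi`: injective over any field of
characteristic `0` by the finite index of `(f^P)_* π₁(C(ℂ))`, and the dimensions agree).
[cite: Lange2023AbelianVarietiesC, §4.1.1 and Lemma 4.4.1 (proof)] -/
theorem bijective_complexBetti_map_abelJacobi_of_isIso_at (hC : Motives.IsSmoothProjective 1 C)
    (P : Motives.AlgPoints C ℂ) [IsIso (Motives.bettiCohomology.map (𝒥.abelJacobi P) 1)] :
    Function.Bijective (complexBetti.map (𝒥.abelJacobi P) 1) := by
  haveI := finite_complexBetti_of_isSmoothProjective hC 1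
  haveI := finite_complexBetti_abelianVariety 𝒥.J 1
  have hinj : Function.Injective (complexBetti.map (𝒥.abelJacobi P) 1) :=
    (singularCohomology_map_injective_iff_of_field ℂ _ 1).mpr
      (singularHomology.map_one_surjective_of_index_ne_zero (Y := 𝒥.J.Points ℂ) ℂ
        (Motives.AlgPoints.mapContinuous (L := ℂ) (𝒥.abelJacobi P)) P
        (Motives.Jacobian.index_range_map_abelJacobi_ne_zero hC 𝒥 P))
  have heq : Module.finrank ℂ (complexBetti 𝒥.J.X 1) = Module.finrank ℂ (complexBetti C 1) := by
    rw [finrank_complexBetti_eq_finrank_bettiCohomology, finrank_complexBetti_eq_finrank_bettiCohomology]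
    exact LinearEquiv.finrank_eq (asIso (Motives.bettiCohomology.map (𝒥.abelJacobi P) 1)).toLinearEquiv
  exact ⟨hinj, (LinearMap.injective_iff_surjective_of_finrank_eq_finrank heq).mp hinj⟩

/-- **`b₁(C(ℂ)) ≤ 2 dim J` ⇒ `(f^P)^*` bijective on `H¹(-; ℂ)`** for THIS curve (Milne Prop. 2.1, open
half, as a hypothesis; the criterion `Jacobian.isIso_bettiCohomology_map_abelJacobi_of_finrank_le_two_mul_dim`
of `Motives/JacobianDimensionBounds` supplies the isomorphism over `ℚ`).
[cite: Milne1986JacobianVarieties, §2 Prop. 2.1 and Thm. 2.5] [cite: Lange2023AbelianVarietiesC, §4.1.1] -/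
theorem bijective_complexBetti_map_abelJacobi_of_finrank_le (hC : Motives.IsSmoothProjective 1 C)
    (hb : Module.finrank ℚ (Motives.bettiCohomology C 1) ≤ 2 * 𝒥.J.dim) (P : Motives.AlgPoints C ℂ) :
    Function.Bijective (complexBetti.map (𝒥.abelJacobi P) 1) := by
  haveI := Motives.Jacobian.isIso_bettiCohomology_map_abelJacobi_of_finrank_le_two_mul_dim hC 𝒥 P hb
  exact bijective_complexBetti_map_abelJacobi_of_isIso_at 𝒥 hC P

/-- **`tr ((s^*)ʲ | H¹(J)) = tr ((α^*)ʲ | H¹(C))`** for `s = α_*`, from `b₁(C(ℂ)) ≤ 2 dim J` for this curve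
(per-curve form of `trace_pow_complexBetti_map_pushforward_eq`). [cite: Lange2023AbelianVarietiesC, §4.5.2 and Lemma 4.4.1 (proof)] -/
theorem trace_pow_complexBetti_map_pushforward_eq_of_finrank_le (hC : Motives.IsSmoothProjective 1 C)
    (hb : Module.finrank ℚ (Motives.bettiCohomology C 1) ≤ 2 * 𝒥.J.dim) (α : C ⟶ C) (j : ℕ) :
    LinearMap.trace ℂ _ ((complexBetti.map (𝒥.pushforward 𝒥 α).hom.hom.hom 1).hom ^ j) =
      LinearMap.trace ℂ _ ((complexBetti.map α 1).hom ^ j) := by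
  haveI := finite_complexBetti_of_isSmoothProjective hC 1
  haveI := finite_complexBetti_abelianVariety 𝒥.J 1
  obtain ⟨P⟩ : Nonempty (Motives.AlgPoints C ℂ) := Motives.nonempty_algPoints_of_isSmoothProjective hC
  have hsq := complexBetti_map_pushforward_comp_map_abelJacobi 𝒥 α P 1
  have h : (complexBetti.map (𝒥.abelJacobi P) 1).hom ∘ₗ (complexBetti.map (𝒥.pushforward 𝒥 α).hom.hom.hom 1).hom =
      (complexBetti.map α 1).hom ∘ₗ (complexBetti.map (𝒥.abelJacobi P) 1).hom := by
    rw [← ModuleCat.hom_comp, hsq, ModuleCat.hom_comp]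
  exact trace_pow_eq_of_comp_eq (bijective_complexBetti_map_abelJacobi_of_finrank_le 𝒥 hC hb P) h j

/-- **`dim B = 8` for Schoen's primitive Prym `B = (Ker (𝟙 - α_* + α_*²))⁰`** of an étale `ℤ/6`-cover
with `dim J(C) = 25`, from the single inequality `b₁(C(ℂ)) ≤ 2 dim J` for the curve itself (in place
of the named fact `Motives.isIso_bettiCohomology_map_abelJacobi` for all curves): the Chevalley–Weil
count `6·dim ker Φ₆ = 2·50 + (tr S + tr S⁵) - (tr S² + tr S⁴) - 2 tr S³` with the Lefschetz sums of
`lefschetz_sums_of_pow_six` (Smith theory + transfer on `C(ℂ)`), as in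
`dim_kerComponent_cyclotomic₆_pushforward_eq_eight_of_isIso`.
[cite: PatelZhang2025PrymHodge, Lemma 2.9 and Lemma 5.1] [cite: Schoen1988HodgeWeil, Lemma 1.5]
[cite: Milne1986JacobianVarieties, §2 Prop. 2.1] -/
theorem dim_kerComponent_cyclotomic₆_pushforward_eq_eight_of_finrank_le (α : C ⟶ C)
    (hC : Motives.IsSmoothProjective 1 C) (h25 : 𝒥.J.dim = 25)
    (hb : Module.finrank ℚ (Motives.bettiCohomology C 1) ≤ 2 * 𝒥.J.dim)
    (hα : α ≫ α ≫ α ≫ α ≫ α ≫ α = 𝟙 C)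
    (hfree : ∀ P : Motives.ComplexPoints C, P ≫ (α ≫ α) ≠ P ∧ P ≫ (α ≫ α ≫ α) ≠ P)
    {s : 𝒥.J ⟶ 𝒥.J} (hs : s = 𝒥.pushforward 𝒥 α) :
    (Motives.AbelianVariety.kerComponent (𝟙 𝒥.J - s + s ≫ s)).dim = 8 := by
  haveI := finite_complexBetti_abelianVariety 𝒥.J 1
  set S := (complexBetti.map s.hom.hom.hom 1).hom with hSdef
  -- `2 dim B = dim ker (1 - S + S²)`
  have hD := two_mul_dim_kerComponent_eq_finrank_ker (𝟙 𝒥.J - s + s ≫ s)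
  rw [complexBetti_map_cyclotomic₆_one_hom, ← hSdef] at hD
  -- `S⁶ = 1`, `dim H¹(J) = 50`
  have hS6 : S ^ 6 = 1 := complexBetti_map_one_hom_pow_six (pushforward_comp_pow_six_of_pow_six 𝒥 hα hs)
  have h50 : Module.finrank ℂ (complexBetti 𝒥.J.X 1) = 50 := by
    rw [Motives.AbelianVariety.finrank_complexBetti_one, h25]
  -- the traces: `tr Sʲ = tr((α^*)ʲ|H¹(C)) = tr(H⁰) + tr(H²) - L j = 1 + lʲ - L j`
  set l := LinearMap.trace ℂ _ (complexBetti.map α 2).hom with hl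
  have hl2 : l ^ 2 = 1 := sq_trace_complexBetti_map_two_eq_one hC α hα
  obtain ⟨hL3, hL24, hL15⟩ := lefschetz_sums_of_pow_six hC α hα hfree
  set L : ℕ → ℂ := fun j =>
    LinearMap.trace ℂ _ ((complexBetti.map α 0).hom ^ j) -
      LinearMap.trace ℂ _ ((complexBetti.map α 1).hom ^ j) +
      LinearMap.trace ℂ _ ((complexBetti.map α 2).hom ^ j) with hLdef
  have htr : ∀ j : ℕ, 1 ≤ j → j ≤ 5 → LinearMap.trace ℂ _ (S ^ j) = 1 + l ^ j - L j := by
    intro j _ _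
    rw [hSdef, hs, trace_pow_complexBetti_map_pushforward_eq_of_finrank_le 𝒥 hC hb α j]
    simp only [hLdef]
    rw [trace_pow_complexBetti_map_zero hC α j, trace_pow_complexBetti_map_two_of_curve hC α j]
    ring
  have h16 := finrank_ker_cyclotomic₆_eq_sixteen_of_sums S hS6 h50 hl2 L hL3 hL24 hL15 htr
  omega

end JacobianPerCurve

/-! ### §5 Assemblies: Schoen's fact from the two kernels -/

section Assembly

/-- **Schoen's fact from its two kernels.** The named fact
`Schoen1988_cyclicPrym_weilClasses_algebraic_degreeSix` (Schoen 1988, Cor. 3.1 with Thm. 2.0;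
Patel–Zhang 2025, Thm 5.3) follows from, for each Schoen datum `(C, 𝒥, α, s = α_*, B, s_B, ψ₀)`:
(i′) the inequality `b₁(C(ℂ)) ≤ 2 dim J(C)` for the curve itself (the open half of Milne Prop. 2.1
`dim J = g`; it gives `dim B = 8`, `dim_kerComponent_cyclotomic₆_pushforward_eq_eight_of_finrank_le`), and
(iii′) ONE non-zero algebraic class in the Weil plane `E₊ ⊔ E₋` of `(B, ψ₀)` (Schoen's cycle `z_χ`,
Thm. 2.0 / Cor. 3.1; Patel–Zhang Prop. 3.2, Thm. 4.4 — NOT in the tree), by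
`eigenspace_sup_eigenspace_le_algebraicClasses_of_exists`.
[cite: Schoen1988HodgeWeil, Cor. 3.1 (p. 24) with Thm. 2.0 (p. 11, proof p. 13)]
[cite: PatelZhang2025PrymHodge, Lemma 5.1, Thm 4.4, Thm 5.3] [cite: Milne1986JacobianVarieties, §2 Prop. 2.1] -/
theorem Schoen1988_cyclicPrym_weilClasses_algebraic_degreeSix_of_finrank_le_of_exists_weilClass
    (hb : ∀ (C : Motives.SchemeOver ℂ) (𝒥 : Jacobian C) (α : C ⟶ C),
      Motives.IsSmoothProjective 1 C → 𝒥.J.dim = 25 →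
      α ≫ α ≫ α ≫ α ≫ α ≫ α = 𝟙 C →
      (∀ P : Motives.ComplexPoints C, P ≫ (α ≫ α) ≠ P ∧ P ≫ (α ≫ α ≫ α) ≠ P) →
      Module.finrank ℚ (Motives.bettiCohomology C 1) ≤ 2 * 𝒥.J.dim)
    (hZ : ∀ (C : Motives.SchemeOver ℂ) (𝒥 : Jacobian C) (α : C ⟶ C),
      Motives.IsSmoothProjective 1 C → 𝒥.J.dim = 25 →
      α ≫ α ≫ α ≫ α ≫ α ≫ α = 𝟙 C →
      (∀ P : Motives.ComplexPoints C, P ≫ (α ≫ α) ≠ P ∧ P ≫ (α ≫ α ≫ α) ≠ P) →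
    ∀ (s : 𝒥.J ⟶ 𝒥.J), s = 𝒥.pushforward 𝒥 α →
    ∀ (sB ψ₀ : Motives.AbelianVariety.kerComponent (𝟙 𝒥.J - s + s ≫ s) ⟶
        Motives.AbelianVariety.kerComponent (𝟙 𝒥.J - s + s ≫ s)),
      sB ≫ Motives.AbelianVariety.kerComponentι (𝟙 𝒥.J - s + s ≫ s) =
        Motives.AbelianVariety.kerComponentι (𝟙 𝒥.J - s + s ≫ s) ≫ s →
      ψ₀ = 𝟙 _ + 2 • (sB ≫ sB) →
      ∃ c ∈ Module.End.eigenspace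
            (complexBetti.map ((2 : ℤ) • 𝟙 (Motives.AbelianVariety.kerComponent (𝟙 𝒥.J - s + s ≫ s)) +
              ψ₀).hom.hom.hom 8).hom ((2 + Complex.I * (Real.sqrt (3 : ℝ) : ℂ)) ^ 8) ⊔
          Module.End.eigenspace
            (complexBetti.map ((2 : ℤ) • 𝟙 (Motives.AbelianVariety.kerComponent (𝟙 𝒥.J - s + s ≫ s)) +
              ψ₀).hom.hom.hom 8).hom ((2 - Complex.I * (Real.sqrt (3 : ℝ) : ℂ)) ^ 8),
        c ∈ algebraicClasses (Motives.AbelianVariety.kerComponent (𝟙 𝒥.J - s + s ≫ s)).X 4 ∧ c ≠ 0) :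
    Schoen1988_cyclicPrym_weilClasses_algebraic_degreeSix := by
  intro C 𝒥 α hC h25 hα hfree s hs sB ψ₀ hsB hψ₀ c hc
  exact eigenspace_sup_eigenspace_le_algebraicClasses_of_exists
    (dim_kerComponent_cyclotomic₆_pushforward_eq_eight_of_finrank_le 𝒥 α hC h25 (hb C 𝒥 α hC h25 hα hfree)
      hα hfree hs)
    (kerComponent_weilOperator_comp_self' hsB hψ₀) (hZ C 𝒥 α hC h25 hα hfree s hs sB ψ₀ hsB hψ₀) hc

/-- **Schoen's fact from `two_mul_dim_eq_finrank_bettiCohomology` and one algebraic Weil class**: the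
named fact `2 dim J = b₁(C(ℂ))` of `Motives/Jacobian` (Milne Prop. 2.1 — the root of the tree's
Jacobian debt, equivalent over `ℂ` to `isIso_bettiCohomology_map_abelJacobi` by
`two_mul_dim_eq_finrank_bettiCohomology_iff_isIso`) supplies (i′).
[cite: Milne1986JacobianVarieties, §2 Prop. 2.1 and Thm. 2.5] [cite: Schoen1988HodgeWeil, Cor. 3.1 (p. 24) with Thm. 2.0] -/
theorem Schoen1988_cyclicPrym_weilClasses_algebraic_degreeSix_of_two_mul_dim_eq_of_exists_weilClass
    (hT : Motives.two_mul_dim_eq_finrank_bettiCohomology)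
    (hZ : ∀ (C : Motives.SchemeOver ℂ) (𝒥 : Jacobian C) (α : C ⟶ C),
      Motives.IsSmoothProjective 1 C → 𝒥.J.dim = 25 →
      α ≫ α ≫ α ≫ α ≫ α ≫ α = 𝟙 C →
      (∀ P : Motives.ComplexPoints C, P ≫ (α ≫ α) ≠ P ∧ P ≫ (α ≫ α ≫ α) ≠ P) →
    ∀ (s : 𝒥.J ⟶ 𝒥.J), s = 𝒥.pushforward 𝒥 α →
    ∀ (sB ψ₀ : Motives.AbelianVariety.kerComponent (𝟙 𝒥.J - s + s ≫ s) ⟶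
        Motives.AbelianVariety.kerComponent (𝟙 𝒥.J - s + s ≫ s)),
      sB ≫ Motives.AbelianVariety.kerComponentι (𝟙 𝒥.J - s + s ≫ s) =
        Motives.AbelianVariety.kerComponentι (𝟙 𝒥.J - s + s ≫ s) ≫ s →
      ψ₀ = 𝟙 _ + 2 • (sB ≫ sB) →
      ∃ c ∈ Module.End.eigenspace
            (complexBetti.map ((2 : ℤ) • 𝟙 (Motives.AbelianVariety.kerComponent (𝟙 𝒥.J - s + s ≫ s)) +
              ψ₀).hom.hom.hom 8).hom ((2 + Complex.I * (Real.sqrt (3 : ℝ) : ℂ)) ^ 8) ⊔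
          Module.End.eigenspace
            (complexBetti.map ((2 : ℤ) • 𝟙 (Motives.AbelianVariety.kerComponent (𝟙 𝒥.J - s + s ≫ s)) +
              ψ₀).hom.hom.hom 8).hom ((2 - Complex.I * (Real.sqrt (3 : ℝ) : ℂ)) ^ 8),
        c ∈ algebraicClasses (Motives.AbelianVariety.kerComponent (𝟙 𝒥.J - s + s ≫ s)).X 4 ∧ c ≠ 0) :
    Schoen1988_cyclicPrym_weilClasses_algebraic_degreeSix :=
  Schoen1988_cyclicPrym_weilClasses_algebraic_degreeSix_of_finrank_le_of_exists_weilClass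
    (fun C 𝒥 _ hC _ _ _ => (hT C hC 𝒥).ge) hZ

/-- **Schoen's fact from `isIso_bettiCohomology_map_abelJacobi` and one algebraic Weil class** (the
assembly `…_of_isIso_of_exists` of `…Lefschetz` with hypothesis (iii) weakened from the Weil line `E₊`
to the Weil plane `E₊ ⊔ E₋`). [cite: Lange2023AbelianVarietiesC, §4.1.1 and Lemma 4.4.1]
[cite: Schoen1988HodgeWeil, Cor. 3.1 (p. 24) with Thm. 2.0] -/
theorem Schoen1988_cyclicPrym_weilClasses_algebraic_degreeSix_of_isIso_of_exists_weilClass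
    (hI : Motives.isIso_bettiCohomology_map_abelJacobi)
    (hZ : ∀ (C : Motives.SchemeOver ℂ) (𝒥 : Jacobian C) (α : C ⟶ C),
      Motives.IsSmoothProjective 1 C → 𝒥.J.dim = 25 →
      α ≫ α ≫ α ≫ α ≫ α ≫ α = 𝟙 C →
      (∀ P : Motives.ComplexPoints C, P ≫ (α ≫ α) ≠ P ∧ P ≫ (α ≫ α ≫ α) ≠ P) →
    ∀ (s : 𝒥.J ⟶ 𝒥.J), s = 𝒥.pushforward 𝒥 α →
    ∀ (sB ψ₀ : Motives.AbelianVariety.kerComponent (𝟙 𝒥.J - s + s ≫ s) ⟶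
        Motives.AbelianVariety.kerComponent (𝟙 𝒥.J - s + s ≫ s)),
      sB ≫ Motives.AbelianVariety.kerComponentι (𝟙 𝒥.J - s + s ≫ s) =
        Motives.AbelianVariety.kerComponentι (𝟙 𝒥.J - s + s ≫ s) ≫ s →
      ψ₀ = 𝟙 _ + 2 • (sB ≫ sB) →
      ∃ c ∈ Module.End.eigenspace
            (complexBetti.map ((2 : ℤ) • 𝟙 (Motives.AbelianVariety.kerComponent (𝟙 𝒥.J - s + s ≫ s)) +
              ψ₀).hom.hom.hom 8).hom ((2 + Complex.I * (Real.sqrt (3 : ℝ) : ℂ)) ^ 8) ⊔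
          Module.End.eigenspace
            (complexBetti.map ((2 : ℤ) • 𝟙 (Motives.AbelianVariety.kerComponent (𝟙 𝒥.J - s + s ≫ s)) +
              ψ₀).hom.hom.hom 8).hom ((2 - Complex.I * (Real.sqrt (3 : ℝ) : ℂ)) ^ 8),
        c ∈ algebraicClasses (Motives.AbelianVariety.kerComponent (𝟙 𝒥.J - s + s ≫ s)).X 4 ∧ c ≠ 0) :
    Schoen1988_cyclicPrym_weilClasses_algebraic_degreeSix :=
  Schoen1988_cyclicPrym_weilClasses_algebraic_degreeSix_of_two_mul_dim_eq_of_exists_weilClass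
    (Motives.two_mul_dim_eq_finrank_bettiCohomology_of_isIso hI) hZ

end Assembly

end Literature.AlgebraicGeometry.HodgeTheory

end
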